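import Summits.AtomisticToContinuum.HydrodynamicLimit.Theorems.JParityClosureRateFloorPairFunctionalMarks
import Summits.AtomisticToContinuum.HydrodynamicLimit.Theorems.JParityClosureKineticEnergyTailsApriori
import Literature.MathematicalPhysics.KineticTheory.HardSphereUniformGas
import Literature.Probability.Moments.PairSumVariance
import HarnessLib

/-!
# The B-side of `RateFloor` at rung 0, II: velocity statistics of the pair functional at fixed positions, for a mark with
# bounded sphere integral, and Gaussian second moments (helper file, `--supports stmt-AtomisticToContinuum-13080`)

Crux `JParityClosure.RateFloor` (stmt-AtomisticToContinuum-13080), line `Sketch`, rung-0 stub `stub_staticOpacityFloorRung0`.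
Under the i.i.d. Maxwellian velocity law `N(u, θ)^{⊗(N+1)}` at fixed positions, for a continuous mark with `|Θ Ξ| ≤ C_Θ`
(copies of `EvenStressEnskog.integral_vel_pairFunctional` / `variance_vel_pairFunctional_le` with the truncated even mark replaced by
a general one):

* `integral_vel_pairFunctional_of_bounded` — mean `Θ̄ Q` (`Q` the off-diagonal cone-weight pair average);
* `variance_vel_pairFunctional_le_of_bounded`, `integral_vel_sq_pairFunctional_sub_le_of_bounded` — variance `≤ 8M⁴C_Θ²/(N+1)`
  (Efron–Stein, `variance_weightedPairSum_le`);
* `integral_vel_abs_pairFunctional_sub_le` — the `L¹` form `≤ η/2 + 8M⁴C_Θ²/((N+1)·2η)` (AM–GM);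
* `integral_norm_sub_sq_prod_gauss_le` (`∫‖w − v‖² d(N ⊗ N) ≤ 4(‖u‖² + 3θ)`), `integral_avg_norm_sq_pi_gauss`
  (`∫ (N+1)⁻¹Σ‖vᵢ‖² = ‖u‖² + 3θ`).
-/

noncomputable section

open MeasureTheory ProbabilityTheory Set Filter Topology
open scoped ENNReal InnerProductSpace BigOperators

namespace Summit.AtomisticToContinuum.HydrodynamicLimit.Theorems

namespace RateFloorPairFunctionalUpper

open Literature.Analysis.FluidPDE Literature.MathematicalPhysics.KineticTheory
open Literature.Probability.Moments
open Summit.AtomisticToContinuum.HydrodynamicLimit.Theorems.EvenStressEnskog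

/-! ## Velocity statistics at fixed positions for a mark with bounded sphere integral -/

/-- **Velocity average of the pair functional at fixed positions** (general continuous mark with
`|Θ Ξ| ≤ C_Θ`): `∫ B_r Ξ (zipConfig (x, v), x₀) dv = Θ̄ · (N+1)⁻² Σ_{i ≠ j} b_r(xᵢ, x₀) b_r(xⱼ, x₀)`
(the diagonal terms vanish, `sphereMark_diag`; each off-diagonal pair of velocities is `N(u,θ) ⊗ N(u,θ)`
distributed, `integral_pi_pair`).  Copy of `EvenStressEnskog.integral_vel_pairFunctional` with the truncated even
mark replaced by a general one. [folklore] -/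
theorem integral_vel_pairFunctional_of_bounded {N : ℕ} (u : V3) (θ : ℝ) {Ξ : V3 × V3 × V3 → ℝ} (hΞc : Continuous Ξ)
    {CΘ : ℝ} (hΘb : ∀ v w, |sphereMark Ξ v w| ≤ CΘ) (r : ℝ) (xs : Fin (N + 1) → T3) (x₀ : T3) :
    ∫ vs, pairFunctional r Ξ (zipConfig (xs, vs)) x₀ ∂(Measure.pi fun _ : Fin (N + 1) => gaussMeasure u θ) =
      (∫ p, sphereMark Ξ p.1 p.2 ∂((gaussMeasure u θ).prod (gaussMeasure u θ))) *
        ((((N + 1 : ℕ) : ℝ))⁻¹ * (((N + 1 : ℕ) : ℝ))⁻¹ *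
          ∑ i, ∑ j, if i = j then 0 else coneKernel r (xs i) x₀ * coneKernel r (xs j) x₀) := by
  have hΘc : Continuous fun p : V3 × V3 => sphereMark Ξ p.1 p.2 := continuous_sphereMark hΞc
  have hint : ∀ i j : Fin (N + 1), Integrable (fun vs : Fin (N + 1) → V3 =>
      sphereMark Ξ (vs i) (vs j)) (Measure.pi fun _ : Fin (N + 1) => gaussMeasure u θ) := by
    intro i j
    have hf : Continuous fun vs : Fin (N + 1) → V3 => (vs i, vs j) := (continuous_apply i).prodMk (continuous_apply j)
    refine Integrable.mono' (integrable_const CΘ) (hΘc.comp hf).aestronglyMeasurable (ae_of_all _ fun vs => ?_)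
    rw [Real.norm_eq_abs]
    exact hΘb _ _
  have hterm : ∀ i j : Fin (N + 1), ∫ vs, sphereMark Ξ (vs i) (vs j) ∂(Measure.pi fun _ : Fin (N + 1) => gaussMeasure u θ) =
      if i = j then 0 else ∫ p, sphereMark Ξ p.1 p.2 ∂((gaussMeasure u θ).prod (gaussMeasure u θ)) := by
    intro i j
    split_ifs with hij
    · subst hij; simp_rw [sphereMark_diag]; exact integral_zero _ _
    · exact integral_pi_pair (gaussMeasure u θ) hij hΘc.aestronglyMeasurable
  simp only [pairFunctional_eq_sum, zipConfig_apply]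
  rw [integral_const_mul, integral_finsetSum _ fun i _ => integrable_finsetSum _ fun j _ => (hint i j).const_mul _]
  have inner : ∀ i : Fin (N + 1), ∫ vs, ∑ j, coneKernel r (xs i) x₀ * coneKernel r (xs j) x₀ *
      sphereMark Ξ (vs i) (vs j) ∂(Measure.pi fun _ : Fin (N + 1) => gaussMeasure u θ) =
      (∫ p, sphereMark Ξ p.1 p.2 ∂((gaussMeasure u θ).prod (gaussMeasure u θ))) *
        ∑ j, (if i = j then 0 else coneKernel r (xs i) x₀ * coneKernel r (xs j) x₀) := by
    intro i
    rw [integral_finsetSum _ fun j _ => (hint i j).const_mul _, Finset.mul_sum]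
    refine Finset.sum_congr rfl fun j _ => ?_
    rw [integral_const_mul, hterm]
    split_ifs <;> ring
  simp_rw [inner, ← Finset.mul_sum]
  ring

/-- **Variance of the pair functional in the velocities, at fixed positions** (general continuous mark with
`|Θ Ξ| ≤ C_Θ`, `r > 0`): `Var ≤ 8 M⁴ C_Θ² / (N+1)` (`variance_weightedPairSum_le`; copy of
`EvenStressEnskog.variance_vel_pairFunctional_le`). [folklore] -/
theorem variance_vel_pairFunctional_le_of_bounded {N : ℕ} (u : V3) (θ : ℝ) {Ξ : V3 × V3 × V3 → ℝ} (hΞc : Continuous Ξ)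
    {CΘ : ℝ} (hΘb : ∀ v w, |sphereMark Ξ v w| ≤ CΘ) {r : ℝ} (hr : 0 < r) (xs : Fin (N + 1) → T3) (x₀ : T3) :
    variance (fun vs => pairFunctional r Ξ (zipConfig (xs, vs)) x₀) (Measure.pi fun _ : Fin (N + 1) => gaussMeasure u θ) ≤
      8 * (3 / (Real.pi * r ^ 3)) ^ 4 * CΘ ^ 2 * (((N + 1 : ℕ) : ℝ))⁻¹ := by
  set M : ℝ := 3 / (Real.pi * r ^ 3) with hM
  set n : ℝ := ((N + 1 : ℕ) : ℝ) with hn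
  have hn0 : 0 < n := by rw [hn]; positivity
  have hfun : (fun vs => pairFunctional r Ξ (zipConfig (xs, vs)) x₀) =
      fun vs : Fin (N + 1) → V3 => ∑ a, ∑ b, (n⁻¹ * n⁻¹ *
        (coneKernel r (xs a) x₀ * coneKernel r (xs b) x₀)) *
          (fun p : V3 × V3 => sphereMark Ξ p.1 p.2) (vs a, vs b) := by
    funext vs
    rw [pairFunctional_eq_sum, Finset.mul_sum]
    refine Finset.sum_congr rfl fun a _ => ?_
    rw [Finset.mul_sum]
    refine Finset.sum_congr rfl fun b _ => ?_
    simp only [zipConfig_apply]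
    ring
  have hΘm : Measurable fun p : V3 × V3 => sphereMark Ξ p.1 p.2 := (continuous_sphereMark hΞc).measurable
  have hb : ∀ y : T3, 0 ≤ coneKernel r y x₀ ∧ coneKernel r y x₀ ≤ M := fun y => coneKernel_nonneg_le hr y x₀
  have hw : ∀ a b : Fin (N + 1),
      |n⁻¹ * n⁻¹ * (coneKernel r (xs a) x₀ * coneKernel r (xs b) x₀)| ≤ n⁻¹ * n⁻¹ * (M * M) := by
    intro a b
    rw [abs_of_nonneg (mul_nonneg (mul_nonneg (inv_nonneg.2 hn0.le) (inv_nonneg.2 hn0.le))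
      (mul_nonneg (hb _).1 (hb _).1))]
    exact mul_le_mul_of_nonneg_left (mul_le_mul (hb _).2 (hb _).2 (hb _).1
      ((hb (xs a)).1.trans (hb (xs a)).2)) (mul_nonneg (inv_nonneg.2 hn0.le) (inv_nonneg.2 hn0.le))
  rw [hfun]
  refine (variance_weightedPairSum_le (ι := Fin (N + 1)) (gaussMeasure u θ) hΘm (fun p => hΘb p.1 p.2) hw).trans
    (le_of_eq ?_)
  rw [Fintype.card_fin, ← hn]
  field_simp

/-- **Mean-square deviation of the pair functional from its velocity average**, at fixed positions (general continuous
mark with `|Θ Ξ| ≤ C_Θ`, `r > 0`): `∫ (B_r Ξ − Θ̄ Q)² dv ≤ 8 M⁴ C_Θ² / (N+1)`. [folklore] -/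
theorem integral_vel_sq_pairFunctional_sub_le_of_bounded {N : ℕ} (u : V3) (θ : ℝ) {Ξ : V3 × V3 × V3 → ℝ}
    (hΞc : Continuous Ξ) {CΘ : ℝ} (hΘb : ∀ v w, |sphereMark Ξ v w| ≤ CΘ) {r : ℝ} (hr : 0 < r)
    (xs : Fin (N + 1) → T3) (x₀ : T3) :
    ∫ vs, (pairFunctional r Ξ (zipConfig (xs, vs)) x₀ -
        (∫ p, sphereMark Ξ p.1 p.2 ∂((gaussMeasure u θ).prod (gaussMeasure u θ))) *
          ((((N + 1 : ℕ) : ℝ))⁻¹ * (((N + 1 : ℕ) : ℝ))⁻¹ *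
            ∑ i, ∑ j, if i = j then 0 else coneKernel r (xs i) x₀ * coneKernel r (xs j) x₀)) ^ 2
        ∂(Measure.pi fun _ : Fin (N + 1) => gaussMeasure u θ) ≤
      8 * (3 / (Real.pi * r ^ 3)) ^ 4 * CΘ ^ 2 * (((N + 1 : ℕ) : ℝ))⁻¹ := by
  have hXm : Measurable fun vs : Fin (N + 1) → V3 => pairFunctional r Ξ (zipConfig (xs, vs)) x₀ :=
    (continuous_pairFunctional_comp r hΞc continuous_id continuous_const).measurable.comp
      (measurable_zipConfig.comp (measurable_const.prodMk measurable_id))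
  have hvar := variance_eq_integral (μ := Measure.pi fun _ : Fin (N + 1) => gaussMeasure u θ) hXm.aemeasurable
  rw [integral_vel_pairFunctional_of_bounded u θ hΞc hΘb r xs x₀] at hvar
  rw [← hvar]
  exact variance_vel_pairFunctional_le_of_bounded u θ hΞc hΘb hr xs x₀

/-- **`L¹` form by AM–GM**: for every `η > 0`,
`∫ |B_r Ξ − Θ̄ Q| dv ≤ η/2 + (8 M⁴ C_Θ²/(N+1)) / (2η)` (`|f| ≤ η/2 + f²/(2η)`). [folklore] -/
theorem integral_vel_abs_pairFunctional_sub_le {N : ℕ} (u : V3) (θ : ℝ) {Ξ : V3 × V3 × V3 → ℝ}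
    (hΞc : Continuous Ξ) {CΘ : ℝ} (hΘb : ∀ v w, |sphereMark Ξ v w| ≤ CΘ) {r : ℝ} (hr : 0 < r)
    (xs : Fin (N + 1) → T3) (x₀ : T3) {η : ℝ} (hη : 0 < η) :
    ∫ vs, |pairFunctional r Ξ (zipConfig (xs, vs)) x₀ -
        (∫ p, sphereMark Ξ p.1 p.2 ∂((gaussMeasure u θ).prod (gaussMeasure u θ))) *
          ((((N + 1 : ℕ) : ℝ))⁻¹ * (((N + 1 : ℕ) : ℝ))⁻¹ *
            ∑ i, ∑ j, if i = j then 0 else coneKernel r (xs i) x₀ * coneKernel r (xs j) x₀)|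
        ∂(Measure.pi fun _ : Fin (N + 1) => gaussMeasure u θ) ≤
      η / 2 + 8 * (3 / (Real.pi * r ^ 3)) ^ 4 * CΘ ^ 2 * (((N + 1 : ℕ) : ℝ))⁻¹ / (2 * η) := by
  set Γ : Measure (Fin (N + 1) → V3) := Measure.pi fun _ : Fin (N + 1) => gaussMeasure u θ with hΓ
  set M : ℝ := 3 / (Real.pi * r ^ 3) with hM
  set Θb : ℝ := ∫ p, sphereMark Ξ p.1 p.2 ∂((gaussMeasure u θ).prod (gaussMeasure u θ)) with hΘbdef
  set Q : ℝ := (((N + 1 : ℕ) : ℝ))⁻¹ * (((N + 1 : ℕ) : ℝ))⁻¹ *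
    ∑ i, ∑ j, (if i = j then 0 else coneKernel r (xs i) x₀ * coneKernel r (xs j) x₀) with hQ
  set f : (Fin (N + 1) → V3) → ℝ := fun vs => pairFunctional r Ξ (zipConfig (xs, vs)) x₀ - Θb * Q with hf
  haveI : IsProbabilityMeasure Γ := by rw [hΓ]; infer_instance
  have hfm : Measurable f :=
    ((continuous_pairFunctional_comp r hΞc continuous_id continuous_const).measurable.comp
      (measurable_zipConfig.comp (measurable_const.prodMk measurable_id))).sub measurable_const
  -- uniform bounds
  have hCΘ0 : 0 ≤ CΘ := (abs_nonneg _).trans (hΘb 0 0)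
  have hb : ∀ y : T3, 0 ≤ coneKernel r y x₀ ∧ coneKernel r y x₀ ≤ M := fun y => coneKernel_nonneg_le hr y x₀
  have hM0 : 0 ≤ M := by rw [hM]; positivity
  have hn0 : 0 < (((N + 1 : ℕ) : ℝ)) := by positivity
  have hpF : ∀ vs, |pairFunctional r Ξ (zipConfig (xs, vs)) x₀| ≤ M * M * CΘ := fun vs => by
    rw [pairFunctional_eq_sum]
    refine (abs_const_mul_sum_sum_le_of (B := M * M * CΘ) (by positivity) _ fun i j => ?_).trans (le_of_eq ?_)
    · rw [abs_mul, abs_mul]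
      simp only [zipConfig_apply]
      rw [abs_of_nonneg (hb _).1, abs_of_nonneg (hb _).1]
      exact mul_le_mul (mul_le_mul (hb _).2 (hb _).2 (hb _).1 hM0) (hΘb _ _) (abs_nonneg _) (mul_nonneg hM0 hM0)
    · have hN : ((N : ℝ) + 1) ≠ 0 := by positivity
      push_cast
      field_simp
  have hΘb' : |Θb| ≤ CΘ := by
    have h := norm_integral_le_of_norm_le_const (μ := (gaussMeasure u θ).prod (gaussMeasure u θ))
      (f := fun p : V3 × V3 => sphereMark Ξ p.1 p.2) (C := CΘ)
      (ae_of_all _ fun p => by rw [Real.norm_eq_abs]; exact hΘb p.1 p.2)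
    simpa only [Real.norm_eq_abs, probReal_univ, mul_one] using h
  have hQabs : |Q| ≤ M * M := by
    simp only [hQ]
    refine (abs_const_mul_sum_sum_le_of (B := M * M) (mul_nonneg (inv_nonneg.2 hn0.le) (inv_nonneg.2 hn0.le))
      _ fun i j => ?_).trans (le_of_eq ?_)
    · split_ifs
      · rw [abs_zero]; exact mul_nonneg hM0 hM0
      · rw [abs_mul, abs_of_nonneg (hb _).1, abs_of_nonneg (hb _).1]
        exact mul_le_mul (hb _).2 (hb _).2 (hb _).1 hM0
    · have hN : ((N : ℝ) + 1) ≠ 0 := by positivity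
      push_cast
      field_simp
  have hfb : ∀ vs, |f vs| ≤ M * M * CΘ + CΘ * (M * M) := fun vs =>
    (abs_sub _ _).trans (add_le_add (hpF vs) (by rw [abs_mul]; exact mul_le_mul hΘb' hQabs (abs_nonneg _) hCΘ0))
  have hfi : Integrable (fun vs => |f vs|) Γ :=
    (Integrable.of_bound hfm.aestronglyMeasurable _ (ae_of_all _ fun vs => by rw [Real.norm_eq_abs]; exact hfb vs)).abs
  have hf2i : Integrable (fun vs => f vs ^ 2) Γ := by
    refine Integrable.of_bound (hfm.pow_const 2).aestronglyMeasurable ((M * M * CΘ + CΘ * (M * M)) ^ 2)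
      (ae_of_all _ fun vs => ?_)
    rw [Real.norm_eq_abs, abs_pow]
    exact pow_le_pow_left₀ (abs_nonneg _) (hfb vs) 2
  -- AM–GM pointwise
  have hpt : ∀ vs, |f vs| ≤ η / 2 + f vs ^ 2 / (2 * η) := fun vs => by
    have h2η : 0 < 2 * η := by positivity
    rw [div_add_div _ _ (two_ne_zero) h2η.ne', le_div_iff₀ (by positivity)]
    nlinarith [sq_nonneg (|f vs| - η), sq_abs (f vs), abs_nonneg (f vs)]
  have hsq := integral_vel_sq_pairFunctional_sub_le_of_bounded u θ hΞc hΘb hr xs x₀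
  calc ∫ vs, |f vs| ∂Γ ≤ ∫ vs, (η / 2 + f vs ^ 2 / (2 * η)) ∂Γ :=
        integral_mono hfi ((integrable_const _).add (hf2i.div_const _)) hpt
    _ = η / 2 + (∫ vs, f vs ^ 2 ∂Γ) / (2 * η) := by
        rw [integral_add (integrable_const _) (hf2i.div_const _), integral_const, smul_eq_mul, probReal_univ, one_mul,
          integral_div]
    _ ≤ η / 2 + 8 * (3 / (Real.pi * r ^ 3)) ^ 4 * CΘ ^ 2 * (((N + 1 : ℕ) : ℝ))⁻¹ / (2 * η) := by
        refine add_le_add le_rfl (div_le_div_of_nonneg_right ?_ (by positivity))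
        simpa only [hf, hΘbdef, hQ] using hsq

/-! ## Gaussian second moments on the product and on the velocity configuration -/

/-- `∫ ‖w − v‖² d(N ⊗ N) ≤ 4 (‖u‖² + 3θ)`. [folklore] -/
theorem integral_norm_sub_sq_prod_gauss_le (u : V3) {θ : ℝ} (hθ : 0 < θ) :
    ∫ p : V3 × V3, ‖p.2 - p.1‖ ^ 2 ∂((gaussMeasure u θ).prod (gaussMeasure u θ)) ≤ 4 * (‖u‖ ^ 2 + 3 * θ) := by
  have h1 : Integrable (fun p : V3 × V3 => ‖p.1‖ ^ 2) ((gaussMeasure u θ).prod (gaussMeasure u θ)) :=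
    (integrable_norm_sq_gaussMeasure u θ).comp_fst _
  have h2 : Integrable (fun p : V3 × V3 => ‖p.2‖ ^ 2) ((gaussMeasure u θ).prod (gaussMeasure u θ)) :=
    (integrable_norm_sq_gaussMeasure u θ).comp_snd _
  have hI1 : ∫ p : V3 × V3, ‖p.1‖ ^ 2 ∂((gaussMeasure u θ).prod (gaussMeasure u θ)) = ‖u‖ ^ 2 + 3 * θ := by
    rw [integral_fun_fst (fun v : V3 => ‖v‖ ^ 2), probReal_univ, one_smul, integral_norm_sq_gaussMeasure u hθ]
  have hI2 : ∫ p : V3 × V3, ‖p.2‖ ^ 2 ∂((gaussMeasure u θ).prod (gaussMeasure u θ)) = ‖u‖ ^ 2 + 3 * θ := by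
    rw [integral_fun_snd (fun v : V3 => ‖v‖ ^ 2), probReal_univ, one_smul, integral_norm_sq_gaussMeasure u hθ]
  have hm : AEStronglyMeasurable (fun p : V3 × V3 => ‖p.2 - p.1‖ ^ 2) ((gaussMeasure u θ).prod (gaussMeasure u θ)) :=
    ((continuous_snd.sub continuous_fst).norm.pow 2).aestronglyMeasurable
  have hint : Integrable (fun p : V3 × V3 => ‖p.2 - p.1‖ ^ 2) ((gaussMeasure u θ).prod (gaussMeasure u θ)) :=
    Integrable.mono' ((h1.const_mul 2).add (h2.const_mul 2)) hm (ae_of_all _ fun p => by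
      rw [Real.norm_eq_abs, abs_of_nonneg (sq_nonneg _)]; exact norm_sub_sq_le_two p.1 p.2)
  calc ∫ p : V3 × V3, ‖p.2 - p.1‖ ^ 2 ∂((gaussMeasure u θ).prod (gaussMeasure u θ))
      ≤ ∫ p : V3 × V3, (2 * ‖p.1‖ ^ 2 + 2 * ‖p.2‖ ^ 2) ∂((gaussMeasure u θ).prod (gaussMeasure u θ)) :=
        integral_mono hint ((h1.const_mul 2).add (h2.const_mul 2)) fun p => norm_sub_sq_le_two p.1 p.2
    _ = 4 * (‖u‖ ^ 2 + 3 * θ) := by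
        rw [integral_add (h1.const_mul 2) (h2.const_mul 2), integral_const_mul, integral_const_mul, hI1, hI2]; ring

/-- The mean kinetic energy per particle under the velocity law `N(u,θ)^{⊗(N+1)}`:
`∫ (N+1)⁻¹ Σᵢ ‖vᵢ‖² = ‖u‖² + 3θ`. [folklore] -/
theorem integral_avg_norm_sq_pi_gauss {N : ℕ} (u : V3) {θ : ℝ} (hθ : 0 < θ) :
    ∫ vs, (((N + 1 : ℕ) : ℝ))⁻¹ * ∑ i, ‖vs i‖ ^ 2 ∂(Measure.pi fun _ : Fin (N + 1) => gaussMeasure u θ) = ‖u‖ ^ 2 + 3 * θ := by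
  set Γ : Measure (Fin (N + 1) → V3) := Measure.pi fun _ : Fin (N + 1) => gaussMeasure u θ with hΓ
  have hmarg : ∀ i : Fin (N + 1), ∫ vs, ‖vs i‖ ^ 2 ∂Γ = ‖u‖ ^ 2 + 3 * θ := by
    intro i
    have hmp := (measurePreserving_eval (fun _ : Fin (N + 1) => gaussMeasure u θ) i).map_eq
    have h := integral_map (μ := Γ) (measurable_pi_apply i).aemeasurable
      (f := fun v : V3 => ‖v‖ ^ 2) (continuous_norm.pow 2).aestronglyMeasurable
    rw [hΓ] at h ⊢
    rw [← h, hmp, integral_norm_sq_gaussMeasure u hθ]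
  have hint : ∀ i : Fin (N + 1), Integrable (fun vs : Fin (N + 1) → V3 => ‖vs i‖ ^ 2) Γ := by
    intro i
    have hmp := measurePreserving_eval (fun _ : Fin (N + 1) => gaussMeasure u θ) i
    rw [hΓ]
    exact (hmp.integrable_comp (continuous_norm.pow 2).aestronglyMeasurable).2 (integrable_norm_sq_gaussMeasure u θ)
  rw [integral_const_mul, integral_finsetSum _ fun i _ => hint i]
  simp only [hmarg, Finset.sum_const, Finset.card_univ, Fintype.card_fin, nsmul_eq_mul]
  have hn : (((N + 1 : ℕ) : ℝ)) ≠ 0 := by positivity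
  field_simp

/-- **Registered helper stub `stub_velAbsPairFunctionalSubLe`** of crux stmt-AtomisticToContinuum-13080 (line `Sketch`, input of `stub_staticOpacityFloorRung0`),
closed signature form of the file's main result. [folklore] -/
theorem stub_velAbsPairFunctionalSubLe : ∀ (N : ℕ) (u : V3) (θ : ℝ) (Ξ : V3 × V3 × V3 → ℝ), Continuous Ξ → ∀ (CΘ : ℝ), (∀ v w, |sphereMark Ξ v w| ≤ CΘ) → ∀ (r : ℝ), 0 < r → ∀ (xs : Fin (N + 1) → T3) (x₀ : T3) (η : ℝ), 0 < η → ∫ vs, |pairFunctional r Ξ (zipConfig (xs, vs)) x₀ - (∫ p, sphereMark Ξ p.1 p.2 ∂((gaussMeasure u θ).prod (gaussMeasure u θ))) * ((((N + 1 : ℕ) : ℝ))⁻¹ * (((N + 1 : ℕ) : ℝ))⁻¹ * ∑ i, ∑ j, if i = j then 0 else coneKernel r (xs i) x₀ * coneKernel r (xs j) x₀)| ∂(MeasureTheory.Measure.pi fun _ : Fin (N + 1) => gaussMeasure u θ) ≤ η / 2 + 8 * (3 / (Real.pi * r ^ 3)) ^ 4 * CΘ ^ 2 * (((N + 1 : ℕ)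 : ℝ))⁻¹ / (2 * η) :=
  fun _N u θ _Ξ hΞc _CΘ hΘb _r hr xs x₀ _η hη => integral_vel_abs_pairFunctional_sub_le u θ hΞc hΘb hr xs x₀ hη

/-- The first Gaussian marginal second moment on the product: `∫ ‖v‖² d(N ⊗ N) = ‖u‖² + 3θ`. [folklore] -/
theorem integral_norm_sq_fst_prod_gauss (u : V3) {θ : ℝ} (hθ : 0 < θ) :
    ∫ p : V3 × V3, ‖p.1‖ ^ 2 ∂((gaussMeasure u θ).prod (gaussMeasure u θ)) = ‖u‖ ^ 2 + 3 * θ := by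
  rw [integral_fun_fst (fun v : V3 => ‖v‖ ^ 2), probReal_univ, one_smul, integral_norm_sq_gaussMeasure u hθ]

end RateFloorPairFunctionalUpper

end Summit.AtomisticToContinuum.HydrodynamicLimit.Theorems

end
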